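import Literature.NumberTheory.EllipticCurves.FormalGroupDictionaryProofs
import Literature.NumberTheory.EllipticCurves.GlobalMinimalModel
import Literature.NumberTheory.EllipticCurves.FormalGroupDenominators
import Mathlib.RingTheory.PowerSeries.Inverse
import Mathlib.Analysis.Complex.Basic
import HarnessLib

/-!
# The formal algebra of the Kummer form's `q`-expansion (line `nsf` v18, stub S3-A `stub_kummerAlg`, crux `StarOptBNSF`, stmt-BirchSwinnertonDyer-27047)

**Stub S3-A CLOSED.**  Pure power-series algebra in `ℤ⟦q⟧ ⊂ ℚ⟦q⟧ ⊂ ℂ⟦q⟧`, no analysis and no modular forms.  Data: `W₁/ℚ` globally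
minimal (so `X := formalXMulSq W₁ = z²x(z) ∈ ℤ⟦z⟧`, `X(0) = 1`), the formal square root `B ∈ ℚ⟦z⟧` (`B(0) = 1`, `2B ∈ ℤ⟦z⟧`), the
integral expansion `z = zq ∈ qℤ⟦q⟧` of the formal parameter (`[q¹]z ≠ 0`), and three complex series `Ph, PΦ, PG` (the `q`-expansions of
the Kummer form `h`, of `Φ₁ = x·G₁` and of the RATIONAL denominator `G₁`) tied by the two identities of stub S3-Q:
(i) `PΦ·z² = X(z)·PG`, (ii) `Ph²·z⁴ = (z·B(z))²·PG²`.  Conclusions: (a) `PΦ` is rational; (b) if `D·PΦ ∈ ℤ⟦q⟧` then `2D·Ph ∈ ℤ⟦q⟧`.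
Proof: (a) `z = q·v` with `v(0) ≠ 0` a unit of `ℚ⟦q⟧`, so `PΦ = (X(z)PG/q²)·v⁻²` is rational (the first two coefficients of `X(z)·PG`
vanish because they do after `× v²` on the left).  (b) `ℂ⟦q⟧` is a domain: (i) and (ii) give `(Ph·X(z))² = (zB(z)·PΦ)²`, hence
`Ph·X(z) = ±zB(z)·PΦ`; `X(z) ∈ ℤ⟦q⟧` has constant term `1`, so it is a unit of `ℤ⟦q⟧`, and `2D·Ph = ±(2B)(z)·z·X(z)⁻¹·(D·PΦ) ∈ ℤ⟦q⟧`.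
BSD is not proved by this file; nothing here reads `r_an`.
-/

set_option linter.dupNamespace false
set_option autoImplicit false

noncomputable section

open PowerSeries
open Literature.NumberTheory.EllipticCurves

namespace Summit.BirchSwinnertonDyer.BirchSwinnertonDyer.Theorems.DepletionAtTwo.KummerAlg

/-! ### Small bookkeeping lemmas -/

/-- Constant coefficient of a mapped series. [folklore] -/
theorem constantCoeff_map' {R S : Type*} [CommRing R] [CommRing S] (f : R →+* S) (φ : PowerSeries R) :
    constantCoeff (PowerSeries.map f φ) = f (constantCoeff φ) := by
  rw [← coeff_zero_eq_constantCoeff_apply, coeff_map, coeff_zero_eq_constantCoeff_apply]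

/-- `ℚ → ℂ` after `ℤ → ℚ` is `ℤ → ℂ` on power series. [folklore] -/
theorem map_rat_map_int (φ : PowerSeries ℤ) :
    PowerSeries.map (algebraMap ℚ ℂ) (PowerSeries.map (Int.castRingHom ℚ) φ) =
      PowerSeries.map (Int.castRingHom ℂ) φ := by
  ext n
  simp [coeff_map]

/-- A complex series with rational coefficients is the image of a rational series. [folklore] -/
theorem exists_map_eq_of_forall_rat {P : PowerSeries ℂ} (hP : ∀ n : ℕ, ∃ r : ℚ, coeff n P = (r : ℂ)) :
    ∃ Q : PowerSeries ℚ, PowerSeries.map (algebraMap ℚ ℂ) Q = P := by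
  choose r hr using hP
  refine ⟨PowerSeries.mk r, ?_⟩
  ext n
  rw [coeff_map, coeff_mk, hr n, eq_ratCast]

/-- A complex series with integer coefficients is the image of an integer series. [folklore] -/
theorem exists_map_eq_of_forall_int {P : PowerSeries ℂ} (hP : ∀ n : ℕ, ∃ z : ℤ, coeff n P = (z : ℂ)) :
    ∃ Q : PowerSeries ℤ, PowerSeries.map (Int.castRingHom ℂ) Q = P := by
  choose z hz using hP
  refine ⟨PowerSeries.mk z, ?_⟩
  ext n
  rw [coeff_map, coeff_mk, hz n, eq_intCast]

/-- The image of a rational series has rational coefficients. [folklore] -/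
theorem forall_rat_of_map (Q : PowerSeries ℚ) (n : ℕ) :
    ∃ r : ℚ, coeff n (PowerSeries.map (algebraMap ℚ ℂ) Q) = (r : ℂ) :=
  ⟨coeff n Q, by rw [coeff_map, eq_ratCast]⟩

/-- `X = formalXMulSq W₁` has INTEGER coefficients for a globally minimal `W₁` (it is the base change of the series of the
integral model). [Silverman AEC IV.1 (p. 116)] [folklore] -/
theorem exists_int_formalXMulSq (W₁ : WeierstrassCurve ℚ) [W₁.IsGloballyMinimal] :
    ∃ Xℤ : PowerSeries ℤ, constantCoeff Xℤ = 1 ∧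
      PowerSeries.map (Int.castRingHom ℚ) Xℤ = W₁.formalXMulSq := by
  refine ⟨(WeierstrassCurve.integralModelInt W₁).formalXMulSq, WeierstrassCurve.constantCoeff_formalXMulSq _, ?_⟩
  rw [WeierstrassCurve.map_formalXMulSq, WeierstrassCurve.map_integralModelInt]

/-- Substitution after base change `ℚ → ℂ` (PowerSeries form of `PowerSeries.map_subst`). [folklore] -/
theorem map_rat_subst {F G : PowerSeries ℚ} (hG : constantCoeff G = 0) :
    PowerSeries.map (algebraMap ℚ ℂ) (F.subst G) =
      (PowerSeries.map (algebraMap ℚ ℂ) F).subst (PowerSeries.map (algebraMap ℚ ℂ) G) :=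
  powerSeries_map_subst (HasSubst.of_constantCoeff_zero' hG) (algebraMap ℚ ℂ) F

/-- Substitution after base change `ℤ → ℂ`. [folklore] -/
theorem map_int_subst {F G : PowerSeries ℤ} (hG : constantCoeff G = 0) :
    PowerSeries.map (Int.castRingHom ℂ) (F.subst G) =
      (PowerSeries.map (Int.castRingHom ℂ) F).subst (PowerSeries.map (Int.castRingHom ℂ) G) :=
  powerSeries_map_subst (HasSubst.of_constantCoeff_zero' hG) (Int.castRingHom ℂ) F

/-- `(C c · F)(G) = C c · F(G)`. [folklore] -/
theorem subst_C_mul {R : Type*} [CommRing R] {G : PowerSeries R} (hG : HasSubst G) (c : R) (F : PowerSeries R) :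
    (C c * F).subst G = C c * F.subst G := by
  rw [← coe_substAlgHom hG, map_mul, C_eq_algebraMap, AlgHom.commutes]

/-! ### The stub -/

/-- **STUB S3-A `stub_kummerAlg` of line `nsf` v18 (crux `StarOptBNSF`, stmt-BirchSwinnertonDyer-27047) — registered signature
verbatim.**  From (i) `PΦ·z² = X(z)·PG` and (ii) `Ph²·z⁴ = (zB(z))²·PG²` with `z = zq ∈ qℤ⟦q⟧`, `[q]z ≠ 0`, `X = formalXMulSq W₁ ∈ ℤ⟦z⟧`
(`W₁` globally minimal, `X(0) = 1`), `B(0) = 1`, `2B ∈ ℤ⟦z⟧`, `PG` rational: (a) `PΦ` is rational; (b) `D·PΦ ∈ ℤ⟦q⟧ ⇒ 2D·Ph ∈ ℤ⟦q⟧`.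
[cite: SilvermanAEC2009, IV.1.1] [folklore] -/
theorem stub_kummerAlg :
    ∀ (W₁ : WeierstrassCurve ℚ) [W₁.IsElliptic] [W₁.IsGloballyMinimal]
      (B : PowerSeries ℚ), PowerSeries.constantCoeff B = 1 → (∀ n : ℕ, ∃ k : ℤ, PowerSeries.coeff n B = (k : ℚ) / 2) →
      ∀ (zq : PowerSeries ℤ), PowerSeries.constantCoeff zq = 0 → PowerSeries.coeff 1 zq ≠ 0 →
      ∀ (Ph PΦ PG : PowerSeries ℂ), (∀ n : ℕ, ∃ r : ℚ, PowerSeries.coeff n PG = (r : ℂ)) →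
      PΦ * (PowerSeries.map (Int.castRingHom ℂ) zq) ^ 2 =
          PowerSeries.map (algebraMap ℚ ℂ) (W₁.formalXMulSq.subst (PowerSeries.map (Int.castRingHom ℚ) zq)) * PG →
      Ph ^ 2 * (PowerSeries.map (Int.castRingHom ℂ) zq) ^ 4 =
          (PowerSeries.map (algebraMap ℚ ℂ)
            (PowerSeries.map (Int.castRingHom ℚ) zq * B.subst (PowerSeries.map (Int.castRingHom ℚ) zq))) ^ 2 * PG ^ 2 →
      (∀ n : ℕ, ∃ r : ℚ, PowerSeries.coeff n PΦ = (r : ℂ)) ∧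
      ∀ (D : ℕ), D ≠ 0 → (∀ n : ℕ, ∃ z : ℤ, PowerSeries.coeff n (PowerSeries.C (D : ℂ) * PΦ) = (z : ℂ)) →
        ∀ n : ℕ, ∃ z : ℤ, PowerSeries.coeff n (PowerSeries.C ((2 * D : ℕ) : ℂ) * Ph) = (z : ℂ) := by
  intro W₁ _ _ B hB0 hBhalf zq hz0 hz1 Ph PΦ PG hPG hi hii
  -- names
  set zQ : PowerSeries ℚ := PowerSeries.map (Int.castRingHom ℚ) zq with hzQ
  set zC : PowerSeries ℂ := PowerSeries.map (Int.castRingHom ℂ) zq with hzC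
  set Xz : PowerSeries ℚ := W₁.formalXMulSq.subst zQ with hXz
  set Bz : PowerSeries ℚ := B.subst zQ with hBz
  have hinj : Function.Injective (algebraMap ℚ ℂ) := (algebraMap ℚ ℂ).injective
  have hzQ0 : constantCoeff zQ = 0 := by rw [hzQ, constantCoeff_map', hz0, map_zero]
  have hsQ : HasSubst zQ := HasSubst.of_constantCoeff_zero' hzQ0
  have hzCQ : PowerSeries.map (algebraMap ℚ ℂ) zQ = zC := map_rat_map_int zq
  have hzQC0 : constantCoeff (PowerSeries.map (algebraMap ℚ ℂ) zQ) = 0 := by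
    rw [constantCoeff_map', hzQ0, map_zero]
  have hsQC : HasSubst (PowerSeries.map (algebraMap ℚ ℂ) zQ) := HasSubst.of_constantCoeff_zero' hzQC0
  -- `zq = X * v`, `v(0) ≠ 0`
  obtain ⟨v, hv⟩ : X ∣ zq := X_dvd_iff.mpr hz0
  have hv0 : constantCoeff v ≠ 0 := by
    have h := congrArg (coeff 1) hv
    rw [coeff_succ_X_mul, coeff_zero_eq_constantCoeff] at h
    rwa [h] at hz1
  have hzC_eq : zC = X * PowerSeries.map (Int.castRingHom ℂ) v := by
    rw [hzC, hv, map_mul, map_X]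
  have hzC_ne : zC ≠ 0 := by
    intro h0
    have h := congrArg (coeff 1) h0
    rw [hzC, coeff_map, map_zero, eq_intCast, Int.cast_eq_zero] at h
    exact hz1 h
  -- the rational `PG`
  obtain ⟨PGq, hPGq⟩ := exists_map_eq_of_forall_rat hPG
  ------------------------------------------------------------------
  -- (a) rationality of `PΦ`
  ------------------------------------------------------------------
  have hR : PΦ * (PowerSeries.map (Int.castRingHom ℂ) v) ^ 2 * X ^ 2 =
      PowerSeries.map (algebraMap ℚ ℂ) (Xz * PGq) := by
    rw [map_mul, hPGq, ← hi, hzC_eq]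
    ring
  -- the first two coefficients of `Xz * PGq` vanish
  have hlow : ∀ m < 2, coeff m (Xz * PGq) = 0 := by
    intro m hm
    apply hinj
    rw [← coeff_map, ← hR, coeff_mul_X_pow', if_neg (by omega), map_zero]
  obtain ⟨Q, hQ⟩ : X ^ 2 ∣ Xz * PGq := X_pow_dvd_iff.mpr hlow
  have hPΦv : PΦ * (PowerSeries.map (Int.castRingHom ℂ) v) ^ 2 = PowerSeries.map (algebraMap ℚ ℂ) Q := by
    have h : PΦ * (PowerSeries.map (Int.castRingHom ℂ) v) ^ 2 * X ^ 2 =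
        PowerSeries.map (algebraMap ℚ ℂ) Q * X ^ 2 := by
      rw [hR, hQ, map_mul, map_pow, map_X, mul_comm]
    exact mul_right_cancel₀ (pow_ne_zero 2 X_ne_zero) h
  -- `v` is a unit of `ℚ⟦q⟧`
  set vQ : PowerSeries ℚ := PowerSeries.map (Int.castRingHom ℚ) v with hvQ
  have hvQ0 : constantCoeff vQ ≠ 0 := by
    rw [hvQ, constantCoeff_map', eq_intCast]
    exact_mod_cast hv0
  have hvC : PowerSeries.map (algebraMap ℚ ℂ) vQ = PowerSeries.map (Int.castRingHom ℂ) v := map_rat_map_int v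
  have hPΦ : PΦ = PowerSeries.map (algebraMap ℚ ℂ) (Q * (vQ⁻¹) ^ 2) := by
    have hne : (PowerSeries.map (Int.castRingHom ℂ) v) ^ 2 ≠ 0 := by
      refine pow_ne_zero 2 fun h0 ↦ hv0 ?_
      have h := congrArg constantCoeff h0
      rw [constantCoeff_map', map_zero, eq_intCast, Int.cast_eq_zero] at h
      exact h
    refine mul_right_cancel₀ hne ?_
    rw [hPΦv, ← hvC, ← map_pow, ← map_mul, mul_assoc, ← mul_pow, PowerSeries.inv_mul_cancel vQ hvQ0, one_pow,
      mul_one]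
  have hΦrat : ∀ n : ℕ, ∃ r : ℚ, coeff n PΦ = (r : ℂ) := fun n ↦ by
    rw [hPΦ]; exact forall_rat_of_map _ n
  refine ⟨hΦrat, ?_⟩
  ------------------------------------------------------------------
  -- (b) integrality of `2D·Ph`
  ------------------------------------------------------------------
  intro D hD hDint n
  -- the key square identity `(Ph·X(z))² = (zB(z)·PΦ)²`
  have hsq : (Ph * PowerSeries.map (algebraMap ℚ ℂ) Xz) * (Ph * PowerSeries.map (algebraMap ℚ ℂ) Xz) =
      (PowerSeries.map (algebraMap ℚ ℂ) (zQ * Bz) * PΦ) * (PowerSeries.map (algebraMap ℚ ℂ) (zQ * Bz) * PΦ) := by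
    have hne : zC ^ 4 ≠ 0 := pow_ne_zero 4 hzC_ne
    refine mul_right_cancel₀ hne ?_
    have e1 : Ph * PowerSeries.map (algebraMap ℚ ℂ) Xz * (Ph * PowerSeries.map (algebraMap ℚ ℂ) Xz) * zC ^ 4 =
        (Ph ^ 2 * zC ^ 4) * (PowerSeries.map (algebraMap ℚ ℂ) Xz) ^ 2 := by ring
    have e2 : PowerSeries.map (algebraMap ℚ ℂ) (zQ * Bz) * PΦ * (PowerSeries.map (algebraMap ℚ ℂ) (zQ * Bz) * PΦ) *
        zC ^ 4 = (PowerSeries.map (algebraMap ℚ ℂ) (zQ * Bz)) ^ 2 * (PΦ * zC ^ 2) ^ 2 := by ring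
    rw [e1, e2, hii, hi]
    ring
  -- a sign `ε = ±1`
  obtain ⟨ε, hε⟩ : ∃ ε : ℤ, Ph * PowerSeries.map (algebraMap ℚ ℂ) Xz =
      C (ε : ℂ) * (PowerSeries.map (algebraMap ℚ ℂ) (zQ * Bz) * PΦ) := by
    rcases mul_self_eq_mul_self_iff.mp hsq with h | h
    · exact ⟨1, by rw [h, Int.cast_one, map_one, one_mul]⟩
    · exact ⟨-1, by rw [h, Int.cast_neg, Int.cast_one, map_neg, map_one, neg_one_mul]⟩
  -- integer structures
  obtain ⟨Xℤ, hXℤ0, hXℤ⟩ := exists_int_formalXMulSq W₁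
  set Xℤz : PowerSeries ℤ := Xℤ.subst zq with hXℤz
  have hXℤz_map : PowerSeries.map (Int.castRingHom ℂ) Xℤz = PowerSeries.map (algebraMap ℚ ℂ) Xz := by
    rw [hXℤz, map_int_subst hz0, hXz, map_rat_subst hzQ0, ← hXℤ]
    simp only [hzQ, map_rat_map_int]
  have hXℤz0 : constantCoeff Xℤz = 1 := by
    rw [hXℤz, constantCoeff_subst_of_constantCoeff_eq_zero hz0, hXℤ0]
  set Y : PowerSeries ℤ := Xℤz.invOfUnit 1 with hY
  have hXY : Xℤz * Y = 1 := PowerSeries.mul_invOfUnit Xℤz 1 (by rw [hXℤz0, Units.val_one])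
  -- `2B ∈ ℤ⟦z⟧`
  choose kB hkB using hBhalf
  set B2 : PowerSeries ℤ := PowerSeries.mk kB with hB2
  have hB2 : PowerSeries.map (Int.castRingHom ℚ) B2 = C (2 : ℚ) * B := by
    ext m
    rw [coeff_map, hB2, coeff_mk, coeff_C_mul, hkB m, eq_intCast]
    ring
  have hB2z : PowerSeries.map (Int.castRingHom ℂ) (B2.subst zq) = C (2 : ℂ) * PowerSeries.map (algebraMap ℚ ℂ) Bz := by
    rw [map_int_subst hz0, ← map_rat_map_int B2, hB2, map_mul, map_C, ← hzC, ← hzCQ, subst_C_mul hsQC, hBz,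
      map_rat_subst hzQ0, eq_ratCast, Rat.cast_ofNat]
  -- `D·PΦ ∈ ℤ⟦q⟧`
  obtain ⟨TΦ, hTΦ⟩ := exists_map_eq_of_forall_int hDint
  -- assemble: `C(2D)·Ph·X(z) = ε·zq·B2(z)·TΦ`
  have hmain : C ((2 * D : ℕ) : ℂ) * Ph * PowerSeries.map (Int.castRingHom ℂ) Xℤz =
      PowerSeries.map (Int.castRingHom ℂ) (C ε * (zq * B2.subst zq * TΦ)) := by
    have e1 : C ((2 * D : ℕ) : ℂ) * Ph * PowerSeries.map (Int.castRingHom ℂ) Xℤz =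
        C (2 : ℂ) * C (D : ℂ) * (Ph * PowerSeries.map (algebraMap ℚ ℂ) Xz) := by
      rw [hXℤz_map, Nat.cast_mul, Nat.cast_two, map_mul]; ring
    rw [e1, hε, map_mul, map_mul, map_mul, map_mul, map_C, hB2z, hTΦ, eq_intCast,
      show PowerSeries.map (algebraMap ℚ ℂ) zQ = PowerSeries.map (Int.castRingHom ℂ) zq from map_rat_map_int zq]
    ring
  -- multiply by the inverse `Y` of `X(z)` in `ℤ⟦q⟧`
  have hfinal : C ((2 * D : ℕ) : ℂ) * Ph =
      PowerSeries.map (Int.castRingHom ℂ) (C ε * (zq * B2.subst zq * TΦ) * Y) := by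
    calc C ((2 * D : ℕ) : ℂ) * Ph
        = C ((2 * D : ℕ) : ℂ) * Ph * PowerSeries.map (Int.castRingHom ℂ) (Xℤz * Y) := by
          rw [hXY, map_one, mul_one]
      _ = (C ((2 * D : ℕ) : ℂ) * Ph * PowerSeries.map (Int.castRingHom ℂ) Xℤz) * PowerSeries.map (Int.castRingHom ℂ) Y := by
          rw [map_mul]; ring
      _ = PowerSeries.map (Int.castRingHom ℂ) (C ε * (zq * B2.subst zq * TΦ) * Y) := by
          rw [hmain, ← map_mul]
  exact ⟨coeff n (C ε * (zq * B2.subst zq * TΦ) * Y), by rw [hfinal, coeff_map, eq_intCast]⟩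

end Summit.BirchSwinnertonDyer.BirchSwinnertonDyer.Theorems.DepletionAtTwo.KummerAlg

end
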